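import Summits.ValiantsHypothesis.ValiantsHypothesis.Theorems.NewtonTauWeak.Negative.AlignedPeelingExposure

/-!
# `NewtonTauWeak` (stmt-5904), line `aligned-peeling` refuted — part 5: unique minimisers of the design sumset with one
# point deleted (negative lane)

The series `Theorems/NewtonTauWeak/Negative/AlignedPeeling*.lean` refutes the load-bearing stub `stub_alignedPeeling`
(`∃ C c, AlignedPeeling C c`) of the registered line `aligned-peeling` of crux `NewtonTauWeak`
(stmt-ValiantsHypothesis-5904); see `AlignedPeelingSumset.lean` for the overview.  The LINE dies; the crux itself
stays OPEN; nothing here bears on `VP ≠ VNP`.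

This file: translation/restriction of unique minimisers, `summit_of_isUniqueMin_sumset` (a unique minimiser over the
sumset is a summit), `summit_of_isUniqueMin_erase` (deleting a non-summit creates none), the cone frames `kxDir/kyDir`
with the reconstruction identity `recon` and `dominated_coords`, and `isUniqueMin_erase_summit`: after deleting the
summit at corner `s`, the only possible unique minimisers are the two other summits, the guard point, and the two edge
neighbours `n • c_s + c_(s')` — every other single-factor deviation is dominated.  [folklore]
-/

set_option linter.dupNamespace false
set_option linter.unusedSimpArgs false

namespace Summit.ValiantsHypothesis.ValiantsHypothesis.Theorems.NewtonTauWeak.Negative.AlignedPeelingCex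

open scoped BigOperators
open MvPolynomial Finset
open Summit.ValiantsHypothesis.ValiantsHypothesis.Theorems.NewtonTauWeak.Negative (vert)

noncomputable section

/-- The two kinds of points of `Tgen D X Y`: corners and cone points. -/
theorem mem_Tgen_iff' (D X Y : ℕ) (t : Fin 2 →₀ ℕ) :
    t ∈ Tgen D X Y ↔ (∃ s, t = corner D s) ∨ (∃ s, t = phi D s X Y) := by
  rw [mem_Tgen_iff]
  constructor
  · rintro (h | h | h | h | h | h)
    exacts [Or.inl ⟨0, h⟩, Or.inl ⟨1, h⟩, Or.inl ⟨2, h⟩, Or.inr ⟨0, h⟩, Or.inr ⟨1, h⟩, Or.inr ⟨2, h⟩]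
  · rintro (⟨s, h⟩ | ⟨s, h⟩) <;> fin_cases s <;> simp [h]

/-! ## D.1 Unique minimisers: restriction and translation -/

/-- Restriction of a unique minimiser to a smaller set containing it. -/
theorem IsUniqueMin.mono {ξ₀ ξ₁ : ℝ} {A B : Finset (Fin 2 →₀ ℕ)} {e : Fin 2 →₀ ℕ} (h : IsUniqueMin ξ₀ ξ₁ A e)
    (hB : B ⊆ A) (he : e ∈ B) : IsUniqueMin ξ₀ ξ₁ B e :=
  ⟨he, fun e' he' hne => h.lt e' (hB he') hne⟩

/-- A unique minimiser over a translate is the translate of a unique minimiser. -/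
theorem isUniqueMin_of_image_add (ξ₀ ξ₁ : ℝ) (A : Finset (Fin 2 →₀ ℕ)) (a₀ e : Fin 2 →₀ ℕ)
    (h : IsUniqueMin ξ₀ ξ₁ (A.image (a₀ + ·)) e) : ∃ y ∈ A, e = a₀ + y ∧ IsUniqueMin ξ₀ ξ₁ A y := by
  classical
  obtain ⟨he, hlt⟩ := h
  obtain ⟨y, hy, rfl⟩ := Finset.mem_image.mp he
  refine ⟨y, hy, rfl, hy, fun y' hy' hne => ?_⟩
  have h1 := hlt (a₀ + y') (Finset.mem_image.mpr ⟨y', hy', rfl⟩) (fun h => hne (add_left_cancel h))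
  rw [fv_add, fv_add] at h1
  linarith

/-! ## D.2 Summits as the only sumset minimisers -/

/-- Summits lie in the sumset. -/
theorem summitPt_mem_sumset (n : ℕ) (s : Fin 3) : summitPt n s ∈ sumset (Tfam n) :=
  summit_mem_sumset (Tfam n) _ (fun _ => corner_mem_Tgen _ _ _ s)

/-- Every sumset point is beaten (weakly) by some summit. -/
theorem exists_summit_le (n : ℕ) (ξ₀ ξ₁ : ℝ) (y : Fin 2 →₀ ℕ) (hy : y ∈ sumset (Tfam n)) :
    ∃ s, fv ξ₀ ξ₁ (summitPt n s) ≤ fv ξ₀ ξ₁ y := by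
  classical
  obtain ⟨f, hfpi, hfy⟩ := (mem_sumset_iff _ y).mp hy
  have hf : ∀ i, f i ∈ Tfam n i := Fintype.mem_piFinset.mp hfpi
  set D := side n with hD
  set m := min (fv ξ₀ ξ₁ (corner D 0)) (min (fv ξ₀ ξ₁ (corner D 1)) (fv ξ₀ ξ₁ (corner D 2))) with hm
  have hc0 : fv ξ₀ ξ₁ (corner D 0) = 0 := by simp [fv, corner]
  have hc1 : fv ξ₀ ξ₁ (corner D 1) = ξ₀ * D := by simp [fv, corner]
  have hc2 : fv ξ₀ ξ₁ (corner D 2) = ξ₁ * D := by simp [fv, corner]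
  have hmi : ∀ i, m ≤ fv ξ₀ ξ₁ (f i) := by
    intro i
    refine fv_triangle_ge ξ₀ ξ₁ m D (f i) (tri_of_mem_Tgen D _ _ (cXY_le_side' n i) _ (hf i)) ?_ ?_ ?_
    · rw [← hc0]; exact min_le_left _ _
    · rw [← hc1]; exact (min_le_right _ _).trans (min_le_left _ _)
    · rw [← hc2]; exact (min_le_right _ _).trans (min_le_right _ _)
  have hsum : (n + 1 : ℝ) * m ≤ fv ξ₀ ξ₁ y := by
    rw [← hfy, fv_sum]
    have : ∑ _i : Fin (n + 1), m ≤ ∑ i, fv ξ₀ ξ₁ (f i) := Finset.sum_le_sum fun i _ => hmi i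
    simpa using this
  have hval : ∀ s, fv ξ₀ ξ₁ (summitPt n s) = (n + 1 : ℝ) * fv ξ₀ ξ₁ (corner D s) := by
    intro s; rw [summitPt, fv_nsmul]; push_cast; ring
  -- the minimum is attained at one of the corners
  have hattain : ∃ s, fv ξ₀ ξ₁ (corner D s) = m := by
    rcases min_choice (fv ξ₀ ξ₁ (corner D 0)) (min (fv ξ₀ ξ₁ (corner D 1)) (fv ξ₀ ξ₁ (corner D 2))) with h | h
    · exact ⟨0, h.symm⟩
    · rcases min_choice (fv ξ₀ ξ₁ (corner D 1)) (fv ξ₀ ξ₁ (corner D 2)) with h' | h'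
      · exact ⟨1, by rw [← h', ← h]⟩
      · exact ⟨2, by rw [← h', ← h]⟩
  obtain ⟨s, hs⟩ := hattain
  exact ⟨s, by rw [hval, hs]; exact hsum⟩

/-- **A unique minimiser over the whole sumset is a summit.** -/
theorem summit_of_isUniqueMin_sumset (n : ℕ) (ξ₀ ξ₁ : ℝ) (y : Fin 2 →₀ ℕ)
    (h : IsUniqueMin ξ₀ ξ₁ (sumset (Tfam n)) y) : ∃ s, y = summitPt n s := by
  obtain ⟨s, hs⟩ := exists_summit_le n ξ₀ ξ₁ y h.mem
  by_contra hne
  push Not at hne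
  have := h.lt (summitPt n s) (summitPt_mem_sumset n s) (fun h' => hne s h'.symm)
  linarith

/-- **Deleting a non-summit point does not create new unique minimisers.** -/
theorem summit_of_isUniqueMin_erase (n : ℕ) (ξ₀ ξ₁ : ℝ) (y₀ y : Fin 2 →₀ ℕ) (hy₀ : y₀ ∈ sumset (Tfam n))
    (hns : ∀ s, y₀ ≠ summitPt n s) (h : IsUniqueMin ξ₀ ξ₁ ((sumset (Tfam n)).erase y₀) y) :
    ∃ s, y = summitPt n s := by
  have hyS : y ∈ sumset (Tfam n) := Finset.mem_of_mem_erase h.mem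
  have hle : fv ξ₀ ξ₁ y ≤ fv ξ₀ ξ₁ y₀ := by
    by_contra hlt
    push Not at hlt
    have hU : IsUniqueMin ξ₀ ξ₁ (sumset (Tfam n)) y₀ := ⟨hy₀, fun e he hne => by
      rcases eq_or_ne e y with rfl | hney
      · exact hlt
      · exact hlt.trans (h.lt e (Finset.mem_erase.mpr ⟨hne, he⟩) hney)⟩
    obtain ⟨s, hs⟩ := summit_of_isUniqueMin_sumset n ξ₀ ξ₁ y₀ hU
    exact hns s hs
  obtain ⟨s, hs⟩ := exists_summit_le n ξ₀ ξ₁ y hyS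
  refine ⟨s, ?_⟩
  by_contra hne
  have hmem : summitPt n s ∈ (sumset (Tfam n)).erase y₀ :=
    Finset.mem_erase.mpr ⟨fun h' => hns s h'.symm, summitPt_mem_sumset n s⟩
  have := h.lt _ hmem (fun h' => hne h'.symm)
  linarith

/-! ## D.3 Cone frames: reconstruction of lattice coordinates from cone coordinates -/

/-- The corner in the first cone direction at corner `s`. -/
def kxDir (s : Fin 3) : Fin 3 := if s.val = 0 then 1 else 0

/-- The corner in the second cone direction at corner `s`. -/
def kyDir (s : Fin 3) : Fin 3 := if s.val = 2 then 1 else 2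

/-- The first cone direction is another corner. -/
theorem kxDir_ne (s : Fin 3) : kxDir s ≠ s := by fin_cases s <;> simp [kxDir]

/-- The second cone direction is another corner. -/
theorem kyDir_ne (s : Fin 3) : kyDir s ≠ s := by fin_cases s <;> simp [kyDir]

/-- The two cone directions differ. -/
theorem kxDir_ne_kyDir (s : Fin 3) : kxDir s ≠ kyDir s := by fin_cases s <;> simp [kxDir, kyDir]

/-- Cone functional of the first-direction corner. -/
theorem cval_kxDir (D : ℕ) (s : Fin 3) (A B : ℝ) : cval D s A B (corner D (kxDir s)) = A * D := by
  fin_cases s <;> simp [cval, corner, kxDir]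

/-- Cone functional of the second-direction corner. -/
theorem cval_kyDir (D : ℕ) (s : Fin 3) (A B : ℝ) : cval D s A B (corner D (kyDir s)) = B * D := by
  fin_cases s <;> simp [cval, corner, kyDir]

/-- Cone coordinates of another corner's cone point: one of them is the huge `D - X - Y`, the other is `X` or `Y`. -/
theorem cval_phi_other (D : ℕ) (s s' : Fin 3) (hs : s' ≠ s) (X Y : ℕ) (hXY : X + Y ≤ D) (hX : 1 ≤ X) (hY : 1 ≤ Y) :
    ∃ Z : ℝ, 1 ≤ Z ∧
      ((cval D s 1 0 (phi D s' X Y) = (D : ℝ) - X - Y ∧ cval D s 0 1 (phi D s' X Y) = Z) ∨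
       (cval D s 1 0 (phi D s' X Y) = Z ∧ cval D s 0 1 (phi D s' X Y) = (D : ℝ) - X - Y)) := by
  have hcast : ((D - X - Y : ℕ) : ℝ) = (D : ℝ) - X - Y := by
    rw [Nat.cast_sub (by omega : Y ≤ D - X), Nat.cast_sub (by omega : X ≤ D)]
  have hXr : (1 : ℝ) ≤ X := by exact_mod_cast hX
  have hYr : (1 : ℝ) ≤ Y := by exact_mod_cast hY
  fin_cases s <;> fin_cases s' <;> simp at hs <;>
    simp only [cval, phi, pt_apply_zero, pt_apply_one, hcast, Fin.isValue, Fin.val_zero, Fin.val_one, Fin.val_two,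
      Nat.reduceEqDiff, ↓reduceIte]
  · exact ⟨Y, hYr, Or.inl ⟨by ring, by ring⟩⟩
  · exact ⟨Y, hYr, Or.inr ⟨by ring, by ring⟩⟩
  · exact ⟨Y, hYr, Or.inl ⟨by ring, by ring⟩⟩
  · exact ⟨X, hXr, Or.inr ⟨by ring, by ring⟩⟩
  · exact ⟨X, hXr, Or.inl ⟨by ring, by ring⟩⟩
  · exact ⟨X, hXr, Or.inr ⟨by ring, by ring⟩⟩

/-- **Reconstruction**: lattice coordinates from cone coordinates, `t = c_s + (kx/D)(a_s - c_s) + (ky/D)(b_s - c_s)`. -/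
theorem recon (D : ℕ) (hD : (D : ℝ) ≠ 0) (s : Fin 3) (t : Fin 2 →₀ ℕ) (k : Fin 2) :
    ((t k : ℕ) : ℝ) = ((corner D s k : ℕ) : ℝ) +
      cval D s 1 0 t / D * ((((corner D (kxDir s)) k : ℕ) : ℝ) - ((corner D s k : ℕ) : ℝ)) +
      cval D s 0 1 t / D * ((((corner D (kyDir s)) k : ℕ) : ℝ) - ((corner D s k : ℕ) : ℝ)) := by
  fin_cases s <;> fin_cases k <;> simp [cval, corner, kxDir, kyDir] <;> field_simp <;> ring

/-- **Domination transfer**: a domination identity in cone coordinates gives the lattice-coordinate identities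
required by `not_isUniqueMin_of_dominated` (with `α = u/D`, `β = w/D`). -/
theorem dominated_coords (D : ℕ) (hD : (D : ℝ) ≠ 0) (s : Fin 3) (t t₁ t₂ : Fin 2 →₀ ℕ) (lam u w : ℝ)
    (hx : cval D s 1 0 t = lam * cval D s 1 0 t₁ + (1 - lam) * cval D s 1 0 t₂ + u)
    (hy : cval D s 0 1 t = lam * cval D s 0 1 t₁ + (1 - lam) * cval D s 0 1 t₂ + w) (k : Fin 2) :
    ((t k : ℕ) : ℝ) = lam * t₁ k + (1 - lam) * t₂ k +
      u / D * ((((corner D (kxDir s)) k : ℕ) : ℝ) - ((corner D s k : ℕ) : ℝ)) +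
      w / D * ((((corner D (kyDir s)) k : ℕ) : ℝ) - ((corner D s k : ℕ) : ℝ)) := by
  rw [recon D hD s t k, recon D hD s t₁ k, recon D hD s t₂ k, hx, hy]
  field_simp
  ring

/-! ## D.4 Deleting a summit exposes at most the guard and the two edge neighbours -/

/-- **Unique minimisers after deleting a summit** are: another summit, the guard point, or one of the two nearest
edge points `n • c_s + c_{s'}`. -/
theorem isUniqueMin_erase_summit (n : ℕ) (hn : 1 ≤ n) (s : Fin 3) (ξ₀ ξ₁ : ℝ) (y : Fin 2 →₀ ℕ)
    (h : IsUniqueMin ξ₀ ξ₁ ((sumset (Tfam n)).erase (summitPt n s)) y) :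
    (∃ s', s' ≠ s ∧ y = summitPt n s') ∨ y = guardPt n s ∨
      (∃ s', s' ≠ s ∧ y = n • corner (side n) s + corner (side n) s') := by
  classical
  set D := side n with hDdef
  have hD0 : 0 < D := side_pos n
  have hDr : (D : ℝ) ≠ 0 := by exact_mod_cast hD0.ne'
  have hDr' : (0 : ℝ) < D := by exact_mod_cast hD0
  set c := corner D s with hc
  set a := corner D (kxDir s) with ha
  set b := corner D (kyDir s) with hb
  set g := phi D s 1 1 with hg
  have hac : a ≠ c := fun h' => kxDir_ne s (corner_injective D hD0.ne' h')
  have hbc : b ≠ c := fun h' => kyDir_ne s (corner_injective D hD0.ne' h')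
  have hcone := fun (i : Fin (n + 1)) (t : Fin 2 →₀ ℕ) (ht : t ∈ Tfam n i) =>
    cone_decomp D hD0 s (kxDir s) (kyDir s) (kxDir_ne_kyDir s) (kxDir_ne s) (kyDir_ne s) t
      (tri_of_mem_Tgen D _ _ (cXY_le_side' n i) t ht)
  have hmain := corner_uniqueMin (by omega : 2 ≤ n + 1) (Tfam n) c a b hac hbc
    (fun i => corner_mem_Tgen _ _ _ s) (fun i => corner_mem_Tgen _ _ _ _) (fun i => corner_mem_Tgen _ _ _ _)
    hcone ξ₀ ξ₁ y h
  rcases hmain with hS | ⟨t, htU, hyt, htmin, hpos⟩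
  · obtain ⟨s', rfl⟩ := summit_of_isUniqueMin_sumset n ξ₀ ξ₁ y hS
    refine Or.inl ⟨s', fun h' => ?_, rfl⟩
    exact (Finset.ne_of_mem_erase h.mem) (by rw [h'])
  · have hyt' : y = n • c + t := by rw [hyt]; simp
    -- membership facts in `U`
    set U := Finset.univ.biUnion (fun i => (Tfam n i).erase c) with hU
    have hmemU : ∀ {t'}, t' ∈ U ↔ ∃ i, t' ∈ Tfam n i ∧ t' ≠ c := by
      intro t'; simp only [hU, Finset.mem_biUnion, Finset.mem_univ, true_and, Finset.mem_erase]
      exact ⟨fun ⟨i, hne, hti⟩ => ⟨i, hti, hne⟩, fun ⟨i, hti, hne⟩ => ⟨i, hne, hti⟩⟩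
    have hgT : g ∈ Tfam n 0 := by
      have := phi_mem_Tgen D (cX n 0) (cY n 0) s
      simpa [cX, cY, Tfam] using this
    have hgc : g ≠ c := guard_ne_corner n s
    have hgU : g ∈ U := hmemU.mpr ⟨0, hgT, hgc⟩
    have haU : a ∈ U := hmemU.mpr ⟨0, corner_mem_Tgen _ _ _ _, hac⟩
    have hbU : b ∈ U := hmemU.mpr ⟨0, corner_mem_Tgen _ _ _ _, hbc⟩
    -- cone coordinates of the frame points
    have hg11 : 1 + 1 ≤ D := by have := sq_le_side n; omega
    have hgx : cval D s 1 0 g = 1 := by rw [hg, cval_phi_self _ _ _ _ _ _ hg11]; norm_num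
    have hgy : cval D s 0 1 g = 1 := by rw [hg, cval_phi_self _ _ _ _ _ _ hg11]; norm_num
    have hax : cval D s 1 0 a = D := by rw [ha, cval_kxDir]; ring
    have hay : cval D s 0 1 a = 0 := by rw [ha, cval_kxDir]; ring
    have hbx : cval D s 1 0 b = 0 := by rw [hb, cval_kyDir]; ring
    have hby : cval D s 0 1 b = D := by rw [hb, cval_kyDir]; ring
    obtain ⟨i, hti, htc⟩ := hmemU.mp htU
    have hXY := cXY_le_side' n i
    have hXYD : (cX n i : ℝ) + cY n i + 3 ≤ D := by exact_mod_cast cXY_le_side n i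
    rcases (mem_Tgen_iff' D (cX n i) (cY n i) t).mp hti with ⟨s'', hts⟩ | ⟨s'', hts⟩
    · -- a corner: the deleted one is excluded, the other two are the edge neighbours
      by_cases hs'' : s'' = s
      · exfalso; apply htc; rw [hts, hs'']
      · exact Or.inr (Or.inr ⟨s'', hs'', by rw [hyt', hts]⟩)
    · by_cases hs'' : s'' = s
      · rw [hs''] at hts
        by_cases hi : (i : ℕ) = 0
        · -- the guard point itself
          have htg : t = g := by rw [hts]; simp [hg, cX, cY, hi]
          exact Or.inr (Or.inl (by rw [hyt', htg, hg, hc, hDdef]; rfl))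
        · -- an own chain point: dominated by the guard point
          exfalso
          have htx : cval D s 1 0 t = cX n i := by rw [hts, cval_phi_self _ _ _ _ _ _ hXY]; ring
          have hty : cval D s 0 1 t = cY n i := by rw [hts, cval_phi_self _ _ _ _ _ _ hXY]; ring
          have hX1 : (1 : ℝ) ≤ cX n i := by exact_mod_cast one_le_cX n i
          have hY2 : (2 : ℝ) ≤ cY n i := by exact_mod_cast two_le_cY n i hi
          exact not_isUniqueMin_of_dominated U c a b t g g ξ₀ ξ₁ hpos haU hbU hgU hgU 1
            (((cX n i : ℝ) - 1) / D) (((cY n i : ℝ) - 1) / D) zero_le_one le_rfl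
            (div_nonneg (by linarith) hDr'.le) (div_nonneg (by linarith) hDr'.le)
            (dominated_coords D hDr s t g g 1 _ _ (by rw [htx, hgx]; ring) (by rw [hty, hgy]; ring) 0)
            (dominated_coords D hDr s t g g 1 _ _ (by rw [htx, hgx]; ring) (by rw [hty, hgy]; ring) 1)
            (Or.inl (Or.inr (div_pos (by linarith) hDr'))) htmin
      · -- another corner's cone point: dominated (two shapes)
        exfalso
        obtain ⟨Z, hZ, hshape⟩ := cval_phi_other D s s'' hs'' (cX n i) (cY n i) hXY (one_le_cX n i) (one_le_cY n i)
        rw [← hts] at hshape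
        set lam : ℝ := ((cX n i : ℝ) + cY n i) / ((D : ℝ) - 1) with hlam
        have hlam0 : 0 ≤ lam := div_nonneg (by positivity) (by linarith)
        have hlam1 : lam < 1 := by rw [hlam, div_lt_one (by linarith)]; linarith
        have hD1 : (D : ℝ) - 1 ≠ 0 := by
          have : (0 : ℝ) ≤ (cX n i : ℝ) + cY n i := by positivity
          linarith
        have hlamD : lam * ((D : ℝ) - 1) = (cX n i : ℝ) + cY n i := by rw [hlam, div_mul_cancel₀ _ hD1]
        rcases hshape with ⟨hx1, hy1⟩ | ⟨hx2, hy2⟩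
        · exact not_isUniqueMin_of_dominated U c a b t g a ξ₀ ξ₁ hpos haU hbU hgU haU lam
            (0 / D) ((Z - lam) / D) hlam0 hlam1.le (div_nonneg le_rfl hDr'.le) (div_nonneg (by linarith) hDr'.le)
            (dominated_coords D hDr s t g a lam 0 (Z - lam) (by rw [hx1, hgx, hax]; linarith) (by rw [hy1, hgy, hay]; ring) 0)
            (dominated_coords D hDr s t g a lam 0 (Z - lam) (by rw [hx1, hgx, hax]; linarith) (by rw [hy1, hgy, hay]; ring) 1)
            (Or.inl (Or.inr (div_pos (by linarith) hDr'))) htmin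
        · exact not_isUniqueMin_of_dominated U c a b t g b ξ₀ ξ₁ hpos haU hbU hgU hbU lam
            ((Z - lam) / D) (0 / D) hlam0 hlam1.le (div_nonneg (by linarith) hDr'.le) (div_nonneg le_rfl hDr'.le)
            (dominated_coords D hDr s t g b lam (Z - lam) 0 (by rw [hx2, hgx, hbx]; ring) (by rw [hy2, hgy, hby]; linarith) 0)
            (dominated_coords D hDr s t g b lam (Z - lam) 0 (by rw [hx2, hgx, hbx]; ring) (by rw [hy2, hgy, hby]; linarith) 1)
            (Or.inl (Or.inl (div_pos (by linarith) hDr'))) htmin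

end

end Summit.ValiantsHypothesis.ValiantsHypothesis.Theorems.NewtonTauWeak.Negative.AlignedPeelingCex
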